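import Literature.Computability.Complexity.FKPointLocationCertificates
import Literature.LinearAlgebra.Matrix.BoundedGeneralizedInverse
import Mathlib.LinearAlgebra.FiniteDimensional.Lemmas
import Mathlib.Algebra.BigOperators.Field
import HarnessLib

/-!
# Fournier–Koiran point location, II: integer affine systems — solution sets, directions, small and near solutions

Topic `Literature/Computability/Complexity`, grouping namespace `FKPointLocation`. Toolkit for the
SEARCH part of the point-location procedure of Fournier–Koiran (ICALP 2000 = LIP RR-1999-21, §2.1:
the affine subspaces `E_1 ⊋ E_2 ⊋ ⋯ ⊋ E_j = I^1`, the apex `s_n^k`, and the coarseness of the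
arrangement) in the rendering of `FKPointLocationCertificates.lean`: a SYSTEM is a list of integer
affine equations `a·y = c` on `ℝ^D` (`Eqn D`; chart equations `y_i = ±1` and live forms `ℓ_a = 0`
are both of this shape), with

* `SolSet S` (its real solution set), `dirSub S` (the direction: common kernel of the linear parts),
  `mem_solSet_iff_sub_mem_dirSub`, `solSet_eq_of_subset_of_finrank_eq` (nested non-empty solution
  sets with directions of equal dimension coincide), `finrank_dirSub_lt_of_ssubset` (a STRICT
  inclusion of non-empty solution sets strictly lowers the dimension — the termination measure of
  the chains and of the stable-scale search), `finrank_dirSub_le`;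
* the matrix form `sysMat`/`sysRhs`, `mem_solSet_iff_mulVec`, and — from the bounded integer
  generalized inverse and the coarseness lemma of `BoundedGeneralizedInverse.lean` — the three
  existence statements with EXPLICIT integer sizes that the NP-oracle questions of the procedure
  need: `exists_small_mem_solSet` (a consistent system with entries `≤ B`, constants `≤ β` has a
  solution `N/d`, `d ≤ D!·max(B,1)^D`, `|N_k| ≤ D·D!·max(B,1)^D·β`), `exists_near_mem_solSet`
  (… near any rational point `P/q` at which the residuals are small: the apex), and
  `solSet_nonempty_of_near` (Meyer auf der Heide's coarseness: small residuals at one real point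
  force consistency);
* `meets_iff` — the arithmetic test for "the trace of `ℓ_a = 0` on the chart meets the little cube"
  (`Meets`), as decided by the verifier.

## References

* H. Fournier, P. Koiran, *Lower bounds are not easier over the reals: inside PH*, ICALP 2000,
  LNCS 1853 = LIP RR-1999-21, §2.1 (chains `E_i`, apex, coarseness `r_n`), §2.2 (sizes).
  [FournierKoiran2000]
* F. Meyer auf der Heide, J. ACM 35 (1988), §2 (coarseness). [MeyerAufDerHeide1988]
* A. Schrijver, *Theory of Linear and Integer Programming*, 1986, §3.2 (sizes of solutions).
  [Schrijver1986]
-/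

namespace Literature.Computability.Complexity

namespace FKPointLocation

open Finset Module Matrix

variable {D : ℕ}

/-! ### Systems, solution sets, directions -/

/-- An integer affine equation `a·y = c` on `ℝ^D`, as the pair `(a, c)`. [cite: FournierKoiran2000, §2.1] -/
abbrev Eqn (D : ℕ) : Type := (Fin D → ℤ) × ℤ

/-- The real solution set of a system. [cite: FournierKoiran2000, §2.1 (the affine spaces `E_i`)] -/
def SolSet (S : List (Eqn D)) : Set (Fin D → ℝ) := {y | ∀ e ∈ S, lin e.1 y = e.2}

/-- `lin a 0 = 0`. [folklore] -/
@[simp] theorem lin_zero (a : Fin D → ℤ) : lin a 0 = 0 := by simp [lin]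

/-- The DIRECTION of a system: the common kernel of the linear parts. [folklore] -/
def dirSub (S : List (Eqn D)) : Submodule ℝ (Fin D → ℝ) where
  carrier := {v | ∀ e ∈ S, lin e.1 v = 0}
  add_mem' := by
    intro u v hu hv e he
    rw [lin_add, hu e he, hv e he, add_zero]
  zero_mem' := by intro e _; exact lin_zero _
  smul_mem' := by
    intro c v hv e he
    rw [lin_smul, hv e he, mul_zero]

/-- Membership in the direction. [folklore] -/
theorem mem_dirSub {S : List (Eqn D)} {v : Fin D → ℝ} : v ∈ dirSub S ↔ ∀ e ∈ S, lin e.1 v = 0 :=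
  Iff.rfl

/-- A solution set is a translate of the direction: `y ∈ Sol ↔ y - z ∈ dir` for a solution `z`.
[folklore] -/
theorem mem_solSet_iff_sub_mem_dirSub {S : List (Eqn D)} {z : Fin D → ℝ} (hz : z ∈ SolSet S)
    (y : Fin D → ℝ) : y ∈ SolSet S ↔ y - z ∈ dirSub S := by
  simp only [SolSet, Set.mem_setOf_eq, mem_dirSub, lin_sub] at hz ⊢
  constructor
  · intro h e he; rw [h e he, hz e he, sub_self]
  · intro h e he; have := h e he; rw [hz e he] at this; linarith

/-- Nested non-empty solution sets have nested directions. [folklore] -/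
theorem dirSub_le_of_solSet_subset {S S' : List (Eqn D)} (h : SolSet S' ⊆ SolSet S) {z : Fin D → ℝ}
    (hz : z ∈ SolSet S') : dirSub S' ≤ dirSub S := by
  intro v hv
  have h1 : z + v ∈ SolSet S' := by
    rw [mem_solSet_iff_sub_mem_dirSub hz]; simpa using hv
  have h2 := (mem_solSet_iff_sub_mem_dirSub (h hz) (z + v)).1 (h h1)
  simpa using h2

/-- **Nested non-empty solution sets with directions of the same dimension are equal.**
[cite: FournierKoiran2000, §2.1 (the chain stops when `E_i = I^1`)] -/
theorem solSet_eq_of_subset_of_finrank_eq {S S' : List (Eqn D)} (h : SolSet S' ⊆ SolSet S)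
    {z : Fin D → ℝ} (hz : z ∈ SolSet S')
    (hf : finrank ℝ (dirSub S') = finrank ℝ (dirSub S)) : SolSet S' = SolSet S := by
  have hle := dirSub_le_of_solSet_subset h hz
  have heq : dirSub S' = dirSub S := Submodule.eq_of_le_of_finrank_eq hle hf
  refine Set.Subset.antisymm h fun y hy => ?_
  rw [mem_solSet_iff_sub_mem_dirSub hz, heq]
  exact (mem_solSet_iff_sub_mem_dirSub (h hz) y).1 hy

/-- **A strict inclusion of non-empty solution sets strictly lowers the dimension of the
direction** (termination measure of the chains `E_1 ⊋ E_2 ⊋ ⋯` and of the search for a stable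
scale). [cite: FournierKoiran2000, §2.1 ("note that `j ≤ n`")] -/
theorem finrank_dirSub_lt_of_ssubset {S S' : List (Eqn D)} (h : SolSet S' ⊆ SolSet S)
    {z : Fin D → ℝ} (hz : z ∈ SolSet S') (hne : SolSet S' ≠ SolSet S) :
    finrank ℝ (dirSub S') < finrank ℝ (dirSub S) := by
  have hle : finrank ℝ (dirSub S') ≤ finrank ℝ (dirSub S) :=
    Submodule.finrank_mono (dirSub_le_of_solSet_subset h hz)
  rcases hle.lt_or_eq with hlt | heq
  · exact hlt
  · exact absurd (solSet_eq_of_subset_of_finrank_eq h hz heq) hne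

/-- Directions have dimension `≤ D`. [folklore] -/
theorem finrank_dirSub_le (S : List (Eqn D)) : finrank ℝ (dirSub S) ≤ D := by
  have := Submodule.finrank_le (dirSub S)
  rwa [finrank_fin_fun] at this

/-! ### Matrix form -/

/-- Coefficient matrix of a system (rows indexed by positions in the list). [folklore] -/
def sysMat (S : List (Eqn D)) : Matrix (Fin S.length) (Fin D) ℤ := fun r k => (S.get r).1 k

/-- Right-hand sides of a system. [folklore] -/
def sysRhs (S : List (Eqn D)) : Fin S.length → ℤ := fun r => (S.get r).2

/-- Solutions of the system are solutions of the matrix equation. [folklore] -/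
theorem mem_solSet_iff_mulVec (S : List (Eqn D)) (y : Fin D → ℝ) :
    y ∈ SolSet S ↔ (sysMat S).map (Int.cast : ℤ → ℝ) *ᵥ y = fun r => (sysRhs S r : ℝ) := by
  simp only [SolSet, Set.mem_setOf_eq]
  constructor
  · intro h
    funext r
    have := h (S.get r) (List.get_mem S r)
    simpa [sysMat, sysRhs, mulVec, dotProduct, lin] using this
  · intro h e he
    obtain ⟨r, hr⟩ := List.mem_iff_get.1 he
    have := congrFun h r
    simp only [mulVec, dotProduct, map_apply, sysMat, sysRhs, hr] at this
    simpa [lin] using this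

/-- Entry bound of the matrix from a bound on the equations. [folklore] -/
theorem natAbs_sysMat_le {S : List (Eqn D)} {B : ℕ} (hB : ∀ e ∈ S, ∀ k, (e.1 k).natAbs ≤ B)
    (r : Fin S.length) (k : Fin D) : (sysMat S r k).natAbs ≤ B :=
  hB _ (List.get_mem S r) k

/-! ### Size constants and the generalized inverse of a system -/

/-- `D! · max(B,1)^D`: bound for the non-singular minor `Δ`. [cite: Schrijver1986, §3.2] -/
def detBound (D B : ℕ) : ℕ := D.factorial * (max B 1) ^ D

/-- `D · D! · max(B,1)^D`: bound for the row `ℓ¹`-norms of `C`. [cite: Schrijver1986, §3.2] -/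
def rowBound (D B : ℕ) : ℕ := D * detBound D B

/-- `detBound` is positive. [folklore] -/
theorem detBound_pos (D B : ℕ) : 0 < detBound D B := by
  unfold detBound; positivity

/-- The bounded integer generalized inverse of a system's matrix, with the `D`-uniform bounds.
[cite: Schrijver1986, §3.2 Cor. 3.2b–d] -/
theorem exists_genInverse_sys (S : List (Eqn D)) {B : ℕ} (hB : ∀ e ∈ S, ∀ k, (e.1 k).natAbs ≤ B) :
    ∃ (Δ : ℤ) (C : Matrix (Fin D) (Fin S.length) ℤ), Δ ≠ 0 ∧ Δ.natAbs ≤ detBound D B ∧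
      (∀ i, ∑ r, (C i r).natAbs ≤ rowBound D B) ∧ sysMat S * C * sysMat S = Δ • sysMat S := by
  obtain ⟨r, Δ, C, -, hrD, hΔ, hΔle, hC, hACA⟩ :=
    Literature.LinearAlgebra.Matrix.exists_bounded_genInverse (sysMat S) (natAbs_sysMat_le hB)
  refine ⟨Δ, C, hΔ, ?_, fun i => (hC i).trans ?_, hACA⟩
  · calc Δ.natAbs ≤ r.factorial * B ^ r := hΔle
      _ ≤ r.factorial * (max B 1) ^ r := Nat.mul_le_mul_left _ (Nat.pow_le_pow_left (le_max_left _ _) _)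
      _ ≤ detBound D B := Nat.mul_le_mul (Nat.factorial_le hrD) (Nat.pow_le_pow_right (by simp) hrD)
  · exact Nat.mul_le_mul hrD (Nat.mul_le_mul (Nat.factorial_le hrD) (Nat.pow_le_pow_right (by simp) hrD))

/-- `Δ⁻¹ = sign(Δ) / |Δ|` in a field of characteristic zero (`Δ ≠ 0`). [folklore] -/
theorem inv_cast_eq_sign_div_abs {K : Type*} [Field K] [LinearOrder K] [IsStrictOrderedRing K]
    {Δ : ℤ} (hΔ : Δ ≠ 0) : (Δ : K)⁻¹ = (Δ.sign : K) / |(Δ : K)| := by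
  rcases lt_or_gt_of_ne hΔ with h | h
  · have hK : (Δ : K) < 0 := by exact_mod_cast h
    rw [Int.sign_eq_neg_one_of_neg h, abs_of_neg hK]
    push_cast
    field_simp
  · have hK : (0 : K) < Δ := by exact_mod_cast h
    rw [Int.sign_eq_one_of_pos h, abs_of_pos hK]
    push_cast
    rw [one_div]

/-! ### Small solutions -/

/-- **Small solutions.** A consistent system with coefficients `≤ B` and constants `≤ β` in absolute
value has a rational solution `N/d` with `0 < d ≤ D!·max(B,1)^D` and `|N_k| ≤ D·D!·max(B,1)^D·β`
(namely `Δ⁻¹ C b`). [cite: Schrijver1986, §3.2 Cor. 3.2d; FournierKoiran2000, §2.2 (Cramer bounds for the tops of the pyramids)] -/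
theorem exists_small_mem_solSet (S : List (Eqn D)) {B β : ℕ} (hB : ∀ e ∈ S, ∀ k, (e.1 k).natAbs ≤ B)
    (hβ : ∀ e ∈ S, e.2.natAbs ≤ β) (hne : (SolSet S).Nonempty) :
    ∃ (N : Fin D → ℤ) (d : ℕ), 0 < d ∧ d ≤ detBound D B ∧ (∀ k, (N k).natAbs ≤ rowBound D B * β) ∧
      (fun k => (N k : ℝ) / d) ∈ SolSet S := by
  obtain ⟨Δ, C, hΔ, hΔle, hC, hACA⟩ := exists_genInverse_sys S hB
  obtain ⟨z, hz⟩ := hne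
  set b : Fin S.length → ℝ := fun r => (sysRhs S r : ℝ) with hb
  have hzb : (sysMat S).map (Int.cast : ℤ → ℝ) *ᵥ z = b := (mem_solSet_iff_mulVec S z).1 hz
  have hsol := Literature.LinearAlgebra.Matrix.mulVec_genInverse_solution (K := ℝ) hACA hΔ ⟨z, hzb⟩ 0
  simp only [mulVec_zero, sub_zero, zero_add] at hsol
  refine ⟨fun k => Δ.sign * (C *ᵥ sysRhs S) k, Δ.natAbs, Int.natAbs_pos.2 hΔ, hΔle, fun k => ?_, ?_⟩
  · rw [Int.natAbs_mul]
    have hs : Δ.sign.natAbs = 1 := Int.natAbs_sign_of_ne_zero hΔ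
    rw [hs, one_mul]
    simp only [mulVec, dotProduct]
    calc (∑ r, C k r * sysRhs S r).natAbs ≤ ∑ r, (C k r * sysRhs S r).natAbs := Int.natAbs_sum_le _ _
      _ = ∑ r, (C k r).natAbs * (sysRhs S r).natAbs := by simp [Int.natAbs_mul]
      _ ≤ ∑ r, (C k r).natAbs * β :=
          sum_le_sum fun r _ => Nat.mul_le_mul_left _ (hβ _ (List.get_mem S r))
      _ = (∑ r, (C k r).natAbs) * β := by rw [sum_mul]
      _ ≤ rowBound D B * β := Nat.mul_le_mul_right _ (hC k)
  · rw [mem_solSet_iff_mulVec]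
    have hfun : (fun k => ((Δ.sign * (C *ᵥ sysRhs S) k : ℤ) : ℝ) / (Δ.natAbs : ℕ)) =
        (Δ : ℝ)⁻¹ • (C.map (Int.cast : ℤ → ℝ) *ᵥ b) := by
      funext k
      rw [Pi.smul_apply, smul_eq_mul, inv_cast_eq_sign_div_abs (K := ℝ) hΔ]
      simp only [mulVec, dotProduct, map_apply, hb]
      push_cast
      rw [Nat.cast_natAbs, Int.cast_abs]
      ring
    rw [hfun]
    exact hsol

/-! ### Solutions near a rational point -/

/-- **Solutions near a rational point with small residuals** (the apex). Let the system (entries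
`≤ B`) be consistent, `p = P/q` rational, and `|q·c_e - a_e·P| ≤ R` for every equation. Then there is
a solution `N/d` with `0 < d ≤ q·D!·max(B,1)^D`, `|N_k| ≤ |P_k|·D!·max(B,1)^D + D·D!·max(B,1)^D·R`,
and `|N_k/d - P_k/q| ≤ D·D!·max(B,1)^D · R / q` (namely `p + Δ⁻¹ C (c - A p)`).
[cite: FournierKoiran2000, §2.1–2.2 (the point `s_n^k` of `I^k` and its size); Schrijver1986, §3.2] -/
theorem exists_near_mem_solSet (S : List (Eqn D)) {B : ℕ} (hB : ∀ e ∈ S, ∀ k, (e.1 k).natAbs ≤ B)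
    (hne : (SolSet S).Nonempty) (P : Fin D → ℤ) {q : ℕ} (hq : 0 < q) {R : ℕ}
    (hR : ∀ e ∈ S, ((q : ℤ) * e.2 - ∑ k, e.1 k * P k).natAbs ≤ R) :
    ∃ (N : Fin D → ℤ) (d : ℕ), 0 < d ∧ d ≤ q * detBound D B ∧
      (∀ k, (N k).natAbs ≤ (P k).natAbs * detBound D B + rowBound D B * R) ∧
      (∀ k, |(N k : ℝ) / d - (P k : ℝ) / q| ≤ rowBound D B * R / q) ∧
      (fun k => (N k : ℝ) / d) ∈ SolSet S := by
  obtain ⟨Δ, C, hΔ, hΔle, hC, hACA⟩ := exists_genInverse_sys S hB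
  obtain ⟨z, hz⟩ := hne
  set b : Fin S.length → ℝ := fun r => (sysRhs S r : ℝ) with hb
  set p : Fin D → ℝ := fun k => (P k : ℝ) / q with hp
  have hqR : (0 : ℝ) < q := by exact_mod_cast hq
  have hΔR : (Δ : ℝ) ≠ 0 := by exact_mod_cast hΔ
  have hΔabs : |(Δ : ℝ)| ≠ 0 := abs_ne_zero.2 hΔR
  have hzb : (sysMat S).map (Int.cast : ℤ → ℝ) *ᵥ z = b := (mem_solSet_iff_mulVec S z).1 hz
  have hsol := Literature.LinearAlgebra.Matrix.mulVec_genInverse_solution (K := ℝ) hACA hΔ ⟨z, hzb⟩ p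
  -- integer residuals
  set ρz : Fin S.length → ℤ := fun r => (q : ℤ) * sysRhs S r - (sysMat S *ᵥ P) r with hρz
  have hρR : ∀ r, (ρz r).natAbs ≤ R := fun r => by
    have := hR _ (List.get_mem S r)
    simpa [hρz, sysMat, sysRhs, mulVec, dotProduct] using this
  have hres : b - (sysMat S).map (Int.cast : ℤ → ℝ) *ᵥ p = fun r => (ρz r : ℝ) / q := by
    funext r
    simp only [Pi.sub_apply, hb, hp, hρz, mulVec, dotProduct, map_apply]
    push_cast
    rw [eq_div_iff hqR.ne', sub_mul, sum_mul]
    congr 1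
    · ring
    · exact sum_congr rfl fun x _ => by rw [mul_assoc, div_mul_cancel₀ _ hqR.ne']
  have hresδ : ∀ r, |(b - (sysMat S).map (Int.cast : ℤ → ℝ) *ᵥ p) r| ≤ (R : ℝ) / q := by
    intro r
    simp only [hres]
    rw [abs_div, abs_of_pos hqR]
    refine div_le_div_of_nonneg_right ?_ hqR.le
    rw [← Int.cast_abs, Int.abs_eq_natAbs]; exact_mod_cast hρR r
  -- the correction term
  set corr : Fin D → ℝ := (Δ : ℝ)⁻¹ • (C.map (Int.cast : ℤ → ℝ) *ᵥ (b - (sysMat S).map (Int.cast : ℤ → ℝ) *ᵥ p))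
    with hcorr
  have hcorr_eq : ∀ k, corr k = (Δ.sign : ℝ) * (∑ r, (C k r : ℝ) * ρz r) / (|(Δ : ℝ)| * q) := by
    intro k
    rw [hcorr, hres, Pi.smul_apply, smul_eq_mul, inv_cast_eq_sign_div_abs (K := ℝ) hΔ]
    simp only [mulVec, dotProduct, map_apply]
    have hsumq : ∑ r, (C k r : ℝ) * ((ρz r : ℝ) / q) = (∑ r, (C k r : ℝ) * ρz r) / q := by
      rw [sum_div]; exact sum_congr rfl fun r _ => by ring
    rw [hsumq, div_mul_div_comm]
  -- the solution `p + corr` written as `N / (q |Δ|)`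
  set N : Fin D → ℤ := fun k => P k * Δ.natAbs + Δ.sign * (C *ᵥ ρz) k with hN
  have hid : (fun k => (N k : ℝ) / ((q * Δ.natAbs : ℕ) : ℝ)) = p + corr := by
    funext k
    rw [Pi.add_apply, hcorr_eq, hp, hN]
    simp only [mulVec, dotProduct]
    push_cast
    have hna : ((Δ.natAbs : ℕ) : ℝ) = |(Δ : ℝ)| := by rw [Nat.cast_natAbs, Int.cast_abs]
    simp only [hna]
    field_simp
  refine ⟨N, q * Δ.natAbs, Nat.mul_pos hq (Int.natAbs_pos.2 hΔ), Nat.mul_le_mul_left _ hΔle,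
    fun k => ?_, fun k => ?_, ?_⟩
  · -- size of the numerators
    have hs : Δ.sign.natAbs = 1 := Int.natAbs_sign_of_ne_zero hΔ
    calc (N k).natAbs
        ≤ (P k * Δ.natAbs).natAbs + (Δ.sign * (C *ᵥ ρz) k).natAbs := Int.natAbs_add_le _ _
      _ = (P k).natAbs * Δ.natAbs + ((C *ᵥ ρz) k).natAbs := by
          rw [Int.natAbs_mul, Int.natAbs_mul, hs, one_mul, Int.natAbs_natCast]
      _ ≤ (P k).natAbs * detBound D B + rowBound D B * R := by
          refine Nat.add_le_add (Nat.mul_le_mul_left _ hΔle) ?_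
          simp only [mulVec, dotProduct]
          calc (∑ r, C k r * ρz r).natAbs ≤ ∑ r, (C k r * ρz r).natAbs := Int.natAbs_sum_le _ _
            _ = ∑ r, (C k r).natAbs * (ρz r).natAbs := by simp [Int.natAbs_mul]
            _ ≤ ∑ r, (C k r).natAbs * R := sum_le_sum fun r _ => Nat.mul_le_mul_left _ (hρR r)
            _ = (∑ r, (C k r).natAbs) * R := by rw [sum_mul]
            _ ≤ rowBound D B * R := Nat.mul_le_mul_right _ (hC k)
  · -- distance to `p`
    have h1 := congrFun hid k
    simp only [Pi.add_apply] at h1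
    rw [h1, hp]
    simp only [add_sub_cancel_left]
    have := Literature.LinearAlgebra.Matrix.abs_genInverse_correction_le (K := ℝ) hΔ hC
      (b - (sysMat S).map (Int.cast : ℤ → ℝ) *ᵥ p) (δ := (R : ℝ) / q) (by positivity) hresδ k
    rw [hcorr]
    simpa [mul_div_assoc] using this
  · rw [mem_solSet_iff_mulVec, hid]
    exact hsol

/-! ### Coarseness -/

/-- **Coarseness (Meyer auf der Heide), for systems.** If at one real point `p` every equation of
a system with entries `≤ B` holds up to `δ`, and `δ · ((1 + D²B) · D! · max(B,1)^D) < 1`, then the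
system is consistent. [cite: MeyerAufDerHeide1988, §2; FournierKoiran2000, §2.1 (`1/r_n = n^{n²} 2^{2n² t(n) + O(n²)}`)] -/
theorem solSet_nonempty_of_near (S : List (Eqn D)) {B : ℕ} (hB : ∀ e ∈ S, ∀ k, (e.1 k).natAbs ≤ B)
    (p : Fin D → ℝ) {δ : ℝ} (hres : ∀ e ∈ S, |(e.2 : ℝ) - lin e.1 p| ≤ δ)
    (hsmall : δ * ((1 + D * D * B) * (D.factorial * (max B 1) ^ D)) < 1) : (SolSet S).Nonempty := by
  have hnear : ∀ r, |(sysRhs S r : ℝ) - ((sysMat S).map (Int.cast : ℤ → ℝ) *ᵥ p) r| ≤ δ := by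
    intro r
    have := hres _ (List.get_mem S r)
    simpa [sysRhs, sysMat, mulVec, dotProduct, lin] using this
  obtain ⟨y, hy⟩ := Literature.LinearAlgebra.Matrix.exists_rat_solution_of_near (sysMat S)
    (natAbs_sysMat_le hB) (sysRhs S) p hnear hsmall
  refine ⟨fun k => (y k : ℝ), ?_⟩
  rw [mem_solSet_iff_mulVec]
  funext r
  have := congrArg (fun v : Fin S.length → ℚ => (v r : ℝ)) hy
  simp only [mulVec, dotProduct, map_apply] at this ⊢
  push_cast at this
  exact this

/-! ### The arithmetic test for `Meets` -/

/-- **Arithmetic form of `Meets`.** For a centre `p` lying in the chart (`p_i = χ_i` on fixed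
coordinates) and `ρ ≥ 0`: the trace of `ℓ_a = 0` meets the cube of radius `ρ` around `p` iff
`|ℓ_a(p)| ≤ ρ · ∑_{free i} |a_i|` (when all free coefficients vanish this reads `ℓ_a(p) = 0`).
[cite: FournierKoiran2000, §2.1 (membership in `H_n^k` is decided in NP / here in P from `p`)] -/
theorem meets_iff {χ : Fin D → ℤ} {p : Fin D → ℚ} {ρ : ℚ} (hp : ∀ i, χ i ≠ 0 → p i = χ i)
    (hρ : 0 ≤ ρ) (a : Fin D → ℤ) :
    Meets χ p ρ a ↔
      |∑ i, (a i : ℚ) * p i| ≤ ρ * ∑ i ∈ univ.filter (fun i => χ i = 0), ((a i).natAbs : ℚ) := by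
  classical
  set F := univ.filter (fun i : Fin D => χ i = 0) with hF
  constructor
  · rintro ⟨y, ⟨hfix, hfree⟩, hzero⟩
    -- `ℓ_a(p) = ℓ_a(p - y)` and only free coordinates contribute
    have hdiff : ∑ i, (a i : ℝ) * (p i : ℝ) = ∑ i ∈ F, (a i : ℝ) * ((p i : ℝ) - y i) := by
      have h1 : ∑ i, (a i : ℝ) * (p i : ℝ) = ∑ i, (a i : ℝ) * ((p i : ℝ) - y i) := by
        rw [← sub_zero (∑ i, (a i : ℝ) * (p i : ℝ)), ← hzero, lin, ← sum_sub_distrib]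
        exact sum_congr rfl fun i _ => by ring
      rw [h1, ← sum_filter_add_sum_filter_not univ (fun i => χ i = 0)]
      have h2 : ∑ i ∈ univ.filter (fun i => ¬ χ i = 0), (a i : ℝ) * ((p i : ℝ) - y i) = 0 := by
        refine sum_eq_zero fun i hi => ?_
        rw [mem_filter] at hi
        rw [hfix i hi.2, hp i hi.2]; push_cast; ring
      rw [h2, add_zero]
    have key : |∑ i, (a i : ℝ) * (p i : ℝ)| ≤ ρ * ∑ i ∈ F, ((a i).natAbs : ℝ) := by
      rw [hdiff]
      calc |∑ i ∈ F, (a i : ℝ) * ((p i : ℝ) - y i)| ≤ ∑ i ∈ F, |(a i : ℝ) * ((p i : ℝ) - y i)| :=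
            abs_sum_le_sum_abs _ _
        _ ≤ ∑ i ∈ F, ((a i).natAbs : ℝ) * ρ := by
            refine sum_le_sum fun i hi => ?_
            rw [mem_filter] at hi
            rw [abs_mul, ← Int.cast_abs, Int.abs_eq_natAbs, Int.cast_natCast, abs_sub_comm]
            exact mul_le_mul_of_nonneg_left (hfree i hi.2) (by positivity)
        _ = ρ * ∑ i ∈ F, ((a i).natAbs : ℝ) := by rw [← sum_mul, mul_comm]
    have : ((|∑ i, (a i : ℚ) * p i| : ℚ) : ℝ) ≤ ((ρ * ∑ i ∈ F, ((a i).natAbs : ℚ) : ℚ) : ℝ) := by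
      push_cast; exact key
    exact_mod_cast this
  · intro h
    by_cases hS : ∑ i ∈ F, ((a i).natAbs : ℚ) = 0
    · -- all free coefficients vanish: `p` itself is a zero
      rw [hS, mul_zero, abs_nonpos_iff] at h
      refine ⟨fun i => (p i : ℝ), ⟨fun i hi => by simp [hp i hi], fun i _ => by simpa using hρ⟩, ?_⟩
      simp only [lin]
      have : ((∑ i, (a i : ℚ) * p i : ℚ) : ℝ) = 0 := by rw [h, Rat.cast_zero]
      push_cast at this
      exact this
    · -- move each free coordinate by `- sgn(a_i) · v / Sa` where `v = ℓ_a(p)`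
      set Sa : ℚ := ∑ i ∈ F, ((a i).natAbs : ℚ) with hSa
      have hSapos : 0 < Sa := lt_of_le_of_ne (sum_nonneg fun i _ => by positivity) (Ne.symm hS)
      have hSaR : (0 : ℝ) < Sa := by exact_mod_cast hSapos
      set v : ℚ := ∑ i, (a i : ℚ) * p i with hv
      set w : Fin D → ℚ := fun i => p i - (if χ i = 0 then ((a i).sign : ℚ) else 0) * (v / Sa) with hw
      refine ⟨fun i => (w i : ℝ), ⟨fun i hi => ?_, fun i hi => ?_⟩, ?_⟩
      · simp [hw, hi, hp i hi]
      · have hwi : w i = p i - ((a i).sign : ℚ) * (v / Sa) := by simp [hw, hi]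
        show |(w i : ℝ) - p i| ≤ ρ
        rw [hwi]
        push_cast
        rw [sub_sub_cancel_left, abs_neg]
        have h1 : |((a i).sign : ℝ)| ≤ 1 := by
          rcases lt_trichotomy (a i) 0 with h0 | h0 | h0
          · simp [Int.sign_eq_neg_one_of_neg h0]
          · simp [h0]
          · simp [Int.sign_eq_one_of_pos h0]
        have h2 : |(v : ℝ)| / (Sa : ℝ) ≤ ρ := by
          rw [div_le_iff₀ hSaR]
          have : ((|v| : ℚ) : ℝ) ≤ ((ρ * Sa : ℚ) : ℝ) := by exact_mod_cast h
          push_cast at this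
          exact this
        calc |((a i).sign : ℝ) * ((v : ℝ) / Sa)| = |((a i).sign : ℝ)| * (|(v : ℝ)| / Sa) := by
              rw [abs_mul, abs_div, abs_of_pos hSaR]
          _ ≤ 1 * ρ := mul_le_mul h1 h2 (by positivity) zero_le_one
          _ = ρ := one_mul _
      · -- the form vanishes at the new point
        have hq : ∑ i, (a i : ℚ) * w i = 0 := by
          have h1 : ∑ i, (a i : ℚ) * w i =
              v - (∑ i, (a i : ℚ) * (if χ i = 0 then ((a i).sign : ℚ) else 0)) * (v / Sa) := by
            rw [hv, sum_mul, ← sum_sub_distrib]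
            exact sum_congr rfl fun i _ => by rw [hw]; ring
          have h2 : ∑ i, (a i : ℚ) * (if χ i = 0 then ((a i).sign : ℚ) else 0) = Sa := by
            rw [hSa, sum_filter]
            refine sum_congr rfl fun i _ => ?_
            split_ifs with hc
            · have hna : ((a i).natAbs : ℚ) = |(a i : ℚ)| := by rw [Nat.cast_natAbs, Int.cast_abs]
              rw [hna]
              rcases lt_trichotomy (a i) 0 with h0 | h0 | h0
              · rw [Int.sign_eq_neg_one_of_neg h0, abs_of_neg (by exact_mod_cast h0)]; push_cast; ring
              · simp [h0]
              · rw [Int.sign_eq_one_of_pos h0, abs_of_pos (by exact_mod_cast h0)]; push_cast; ring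
            · simp
          rw [h1, h2, mul_div_cancel₀ _ hSapos.ne', sub_self]
        simp only [lin]
        have := congrArg (fun t : ℚ => (t : ℝ)) hq
        simp only [Rat.cast_zero, Rat.cast_sum, Rat.cast_mul, Rat.cast_intCast] at this
        exact this

end FKPointLocation

end Literature.Computability.Complexity
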